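import Literature.NumberTheory.EllipticCurves.LocalTorsionMultiplicativeProofs
import HarnessLib

/-!
# Route `ByReductionTypeAtTwo`, crux `RankOneAtTwoOffBigImageOddLocal` (stmt-BirchSwinnertonDyer-23716), line
# `refined_kolyvagin_tamagawa_shift_at_two`: FL1 — the parity of `c_ℓ` at a multiplicative prime (helpers, PROVED)

Lead prover `prover-cruxlead-stmt-BirchSwinnertonDyer-23716-g0` (2026-08-28).  Kernel lemma FL1 of the registered skeleton
`Cruxes/RankOneAtTwoOffBigImageOddLocal/Lines/refined_kolyvagin_tamagawa_shift_at_two.lean` (g6, §3⁵; card `shimura-carrier-transfer-at-two`'s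
first rung `CarrierParityAtOddMultiplicative`), landed route-independently (Literature imports only) as a `--supports` helper of the crux:

* `two_dvd_localTamagawaNumber_iff_even` — Tate's algorithm Step 2 at ANY multiplicative prime `ℓ` of a globally minimal `W/ℚ`:
  `2 ∣ c_ℓ(W) ↔ ord_ℓ(Δ_min)` even.  Split: `c_ℓ = n = ord_ℓ Δ` (tree theorem
  `localTamagawaNumber_eq_ordMinimalDiscriminant_of_hasSplitMultiplicativeReductionAt`); non-split: `c_ℓ = 2` or `1` according as `n` is even or
  odd (`localTamagawaNumber_of_hasNonsplitMultiplicativeReductionAt_holds`); transported from the place `v ↔ ℓ` of `𝓞 ℚ` to `ℚ_ℓ` by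
  `localTamagawaNumber_padic_eq_holds` and `LocalTorsionMult.ordMinimalDiscriminant_eq_padicValInt`.
* `two_dvd_localTamagawaNumber_iff_even_padicValRat_Δ` — the same with `ord_ℓ` read on `W.Δ ∈ ℚ` (= `Δ_min` for a globally minimal `W`):
  the skeleton's `CarrierParityAtOddMultiplicative` VERBATIM minus its unused binder `ℓ ≠ 2` (the statement holds at `ℓ = 2` too).

This is the dictionary «`ℓ` is a `2`-carrier (even `c_ℓ`) ↔ `n_ℓ` even» between the line's semistable multi-carrier cell and the exponents of the
Ribet–Takahashi degree package (parity only: at a NON-split carrier `c_ℓ = 2` while `v₂ n_ℓ` may exceed `1`).  BSD is not proved by this; the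
crux is not proved by this (its seven registered stubs are untouched).

References: [SilvermanATAEC1994] IV.9.4 Step 2 and Cor. IV.9.2(d); [SilvermanAEC2009] VIII.8.
-/

set_option linter.dupNamespace false -- tree convention: `Summit.BirchSwinnertonDyer.BirchSwinnertonDyer.Theorems` (summit = sub-problem)
set_option autoImplicit false
noncomputable section

open scoped Classical

namespace Summit.BirchSwinnertonDyer.BirchSwinnertonDyer.Theorems.OffBigImageOddLocalAtTwo

open WeierstrassCurve NumberField IsDedekindDomain Rat.HeightOneSpectrum Literature.NumberTheory.EllipticCurves

/-- **Tate's algorithm Step 2 at ANY multiplicative prime**: for a globally minimal `W/ℚ` with multiplicative reduction at the prime `ℓ`,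
`2 ∣ c_ℓ ↔ ord_ℓ(Δ_min)` is even — split: `c_ℓ = n`; non-split: `c_ℓ ∈ {1, 2}` by the parity of `n`.
[cite: SilvermanATAEC1994, IV.9.4 Step 2 and Cor. IV.9.2(d)] -/
theorem two_dvd_localTamagawaNumber_iff_even (W : WeierstrassCurve ℚ) [W.IsElliptic] [W.IsGloballyMinimal]
    (ℓ : ℕ) [hℓ : Fact ℓ.Prime] (hmult : W.HasMultiplicativeReductionAtPrime ℓ) :
    2 ∣ (W.baseChange ℚ_[ℓ]).localTamagawaNumber ℤ_[ℓ] ↔ Even (padicValInt ℓ W.minimalDiscriminantInt) := by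
  set v : HeightOneSpectrum (𝓞 ℚ) := (primesEquiv (R := 𝓞 ℚ)).symm ⟨ℓ, hℓ.out⟩ with hvdef
  have hv : primesEquiv v = ⟨ℓ, hℓ.out⟩ := Equiv.apply_symm_apply _ _
  have hvℓ : (primesEquiv v : ℕ) = ℓ := congrArg Subtype.val hv
  have hmultv : W.HasMultiplicativeReductionAt v := by
    have key : ∀ q' : Nat.Primes, primesEquiv v = q' →
        (haveI := Fact.mk q'.2; W.HasMultiplicativeReductionAtPrime (q' : ℕ)) →
          W.HasMultiplicativeReductionAt v := by
      rintro q' rfl h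
      exact (hasMultiplicativeReductionAtPrime_iff_hasMultiplicativeReductionAt_ringOfIntegers W v).mp h
    exact key ⟨ℓ, hℓ.out⟩ hv hmult
  rw [localTamagawaNumber_padic_eq_holds W v ℓ hvℓ, ← LocalTorsionMult.ordMinimalDiscriminant_eq_padicValInt W v hvℓ]
  by_cases hs : W.HasSplitMultiplicativeReductionAt v
  · rw [localTamagawaNumber_eq_ordMinimalDiscriminant_of_hasSplitMultiplicativeReductionAt v W hs]
    exact even_iff_two_dvd.symm
  · rw [localTamagawaNumber_of_hasNonsplitMultiplicativeReductionAt_holds v W hmultv hs]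
    split_ifs with he
    · simp [he]
    · simp [he]

/-- **FL1 `CarrierParityAtOddMultiplicative`** (the skeleton's statement, its unused binder `ℓ ≠ 2` dropped): at a multiplicative prime `ℓ` of a
globally minimal `W/ℚ`, `c_ℓ` is even iff `ord_ℓ(Δ(W))` is even, `Δ(W) ∈ ℚ` being the minimal discriminant. [cite: SilvermanATAEC1994, IV.9.4 Step 2 and Cor. IV.9.2(d)] -/
theorem two_dvd_localTamagawaNumber_iff_even_padicValRat_Δ (W : WeierstrassCurve ℚ) [W.IsElliptic] [W.IsGloballyMinimal]
    (ℓ : ℕ) [Fact ℓ.Prime] (hmult : W.HasMultiplicativeReductionAtPrime ℓ) :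
    2 ∣ (W.baseChange ℚ_[ℓ]).localTamagawaNumber ℤ_[ℓ] ↔ Even (padicValRat ℓ W.Δ) := by
  rw [two_dvd_localTamagawaNumber_iff_even W ℓ hmult, ← cast_minimalDiscriminantInt W, padicValRat.of_int, Int.even_coe_nat]

end Summit.BirchSwinnertonDyer.BirchSwinnertonDyer.Theorems.OffBigImageOddLocalAtTwo

end
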